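import Summits.Ventures.PercRepro.S1TriangleCoverSeventeen
import Summits.Ventures.PercRepro.S1CoreCapLemmas

/-!
# PercRepro — THE CONE OF A POINT ON THREE TRIANGLES: PLANE FACTS (p2, gen 25; SUBCLAIM-S1 §6.9 (x), the cap (P10))

Let `x` lie on three triangles `L₁, L₂, L₃` (pairwise meeting in `x` by (C1)), and let `O` be the points outside
the cone `L₁ ∪ L₂ ∪ L₃`. Under (C2) (planes have `≤ 6` points): (a) no rank-`3` set `{x, a₁, a₂, a₃}` takes one
point from each `Lᵢ ∖ x` (the plane of two lines would swallow the third: `7` points); (b) a rank-`3` set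
`{x, a, b, s}` with `a ∈ Lᵢ ∖ x`, `b ∈ Lⱼ ∖ x`, `s ∈ O` determines `s` from `(i, j)` (the plane `cl (Lᵢ ∪ Lⱼ)` has
room for one outside point); (c) two outside points `s, t` are coplanar with `x` and a point of at most one line
`Lᵢ` (the plane `cl {x, s, t}` through two lines would have `7` points). These feed the count of the four-circuits
through `x` (S1ConeNineteen).

* `mem_closure_of_eRk_insert_le` — `r(X ∪ s) ≤ r(X) ⇒ s ∈ cl X`;
* `triangle_subset_closure_pair'` — a triangle lies in the closure of two of its points (S1TriangleSevenB's lemma);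
* `closure_eq_of_mem_triangle` — a triangle is closed under (C1);
* `ncard_closure_le_six_of_eRk_three` — the closure of a rank-`3` set has `≤ 6` points under (C2);
* `eRk_triple_eq_three`, **`not_eRk_three_cone`** (a), **`eq_of_eRk_three_two_lines`** (b),
  **`not_eRk_three_pair_two_lines`** (c).
Axioms: standard.
-/

open scoped Matroid

namespace PercRepro

namespace S1

open Set

variable {α : Type}

/-- `r(insert s X) ≤ r(X)` with `X ⊆ E` finite and `s ∈ E` forces `s ∈ cl X`. -/
theorem mem_closure_of_eRk_insert_le (N : Matroid α) [N.Finite] {X : Set α} (hX : X ⊆ N.E) {s : α}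
    (hs : s ∈ N.E) (h : N.eRk (insert s X) ≤ N.eRk X) : s ∈ N.closure X := by
  by_contra hcl
  have h1 : N.eRk (insert s X) = N.eRk X + 1 := N.eRk_insert_eq_add_one ⟨hs, hcl⟩
  have hfin : N.eRk X ≠ ⊤ := ((N.eRk_le_encard X).trans_lt (N.ground_finite.subset hX).encard_lt_top).ne
  obtain ⟨r, hr⟩ := ENat.ne_top_iff_exists.1 hfin
  rw [h1, ← hr] at h
  have : r + 1 ≤ r := by exact_mod_cast h
  omega

/-- A triangle (given as a circuit of three points) lies in the closure of any two of its points
(`triangle_subset_closure_pair` of S1TriangleSevenB in the `ThmN.triangles` spelling). -/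
theorem triangle_subset_closure_pair' (N : Matroid α) [N.Finite] {T : Set α} (hT : N.IsCircuit T)
    (h3 : T.ncard = 3) {a b : α} (ha : a ∈ T) (hb : b ∈ T) (hab : a ≠ b) : T ⊆ N.closure {a, b} :=
  triangle_subset_closure_pair N (T := T) ⟨hT, h3⟩ ha hb hab

/-- **A triangle is closed under (C1)**: its closure is a rank-`2` set, so it has `≤ 3` points. -/
theorem closure_eq_of_triangle (N : Matroid α) [N.Finite] (hC1 : ∀ L ⊆ N.E, N.eRk L = 2 → L.ncard ≤ 3)
    {T : Set α} (hT : N.IsCircuit T) (h3 : T.ncard = 3) : N.closure T = T := by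
  have hTfin : T.Finite := N.ground_finite.subset hT.subset_ground
  have hr : N.eRk T = 2 := by
    have h := hT.eRk_add_one_eq
    rw [← hTfin.cast_ncard_eq, h3] at h
    have hfin : N.eRk T ≠ ⊤ := ((N.eRk_le_encard T).trans_lt hTfin.encard_lt_top).ne
    obtain ⟨r, hr⟩ := ENat.ne_top_iff_exists.1 hfin
    rw [← hr] at h ⊢
    have : r + 1 = 3 := by exact_mod_cast h
    norm_cast
    omega
  have hcl : N.eRk (N.closure T) = 2 := by rw [N.eRk_closure_eq, hr]
  have hle := hC1 _ (N.closure_subset_ground T) hcl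
  refine (Set.eq_of_subset_of_ncard_le (N.subset_closure T hT.subset_ground) ?_
    (N.ground_finite.subset (N.closure_subset_ground T))).symm
  rw [h3]; exact hle

/-- The closure of a rank-`3` set has at most `6` points under (C2). -/
theorem ncard_closure_le_six_of_eRk_three (N : Matroid α) [N.Finite]
    (hC2 : ∀ P ⊆ N.E, N.eRk P ≤ 3 → P.ncard ≤ 6) {X : Set α} (hX : N.eRk X ≤ 3) :
    (N.closure X).ncard ≤ 6 :=
  hC2 _ (N.closure_subset_ground X) (by rw [N.eRk_closure_eq]; exact hX)

/-- Two distinct triangles through `x` meet exactly in `x` (under (C1)); the union has `5` points. -/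
theorem ncard_union_eq_five_of_trianglesThrough (N : Matroid α) [N.Finite]
    (hC1 : ∀ L ⊆ N.E, N.eRk L = 2 → L.ncard ≤ 3) {x : α} {L L' : Set α}
    (hL : L ∈ ThmN.trianglesThrough N x) (hL' : L' ∈ ThmN.trianglesThrough N x) (hne : L ≠ L') :
    (L ∪ L').ncard = 5 := by
  have hint := ThmN.inter_eq_singleton_of_mem_trianglesThrough N hC1 hL hL' hne
  have h := Set.ncard_union_add_ncard_inter L L' (N.ground_finite.subset hL.1.subset_ground)
    (N.ground_finite.subset hL'.1.subset_ground)
  rw [hint, Set.ncard_singleton, hL.2.1, hL'.2.1] at h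
  omega

/-- `{x, a, b}` has rank `3` for `a ∈ L ∖ x`, `b ∈ L' ∖ x` on two distinct triangles `L, L'` through `x`. -/
theorem eRk_triple_eq_three (N : Matroid α) [N.Finite] (hC1 : ∀ L ⊆ N.E, N.eRk L = 2 → L.ncard ≤ 3)
    {x : α} {L L' : Set α} (hL : L ∈ ThmN.trianglesThrough N x) (hL' : L' ∈ ThmN.trianglesThrough N x)
    (hne : L ≠ L') {a b : α} (ha : a ∈ L) (hax : a ≠ x) (hb : b ∈ L') (hbx : b ≠ x) :
    N.eRk {x, a, b} = 3 := by
  have hxa : ({x, a} : Set α) ⊆ L := by rintro z (rfl | rfl); exact hL.2.2; exact ha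
  have hind : N.Indep {x, a} := hL.1.ssubset_indep (Set.ssubset_iff_subset_ne.2 ⟨hxa, fun h => by
    have := congrArg Set.ncard h; rw [Set.ncard_pair (Ne.symm hax), hL.2.1] at this; omega⟩)
  have hr2 : N.eRk {x, a} = 2 := by rw [hind.eRk_eq_encard, Set.encard_pair (Ne.symm hax)]
  have hcl : N.closure {x, a} = L := by
    apply le_antisymm
    · calc N.closure {x, a} ⊆ N.closure L := N.closure_subset_closure hxa
        _ = L := closure_eq_of_triangle N hC1 hL.1 hL.2.1
    · exact triangle_subset_closure_pair' N hL.1 hL.2.1 hL.2.2 ha (Ne.symm hax)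
  have hbcl : b ∉ N.closure {x, a} := by
    rw [hcl]
    intro hbL
    have hint := ThmN.inter_eq_singleton_of_mem_trianglesThrough N hC1 hL hL' hne
    have : b ∈ L ∩ L' := ⟨hbL, hb⟩
    rw [hint] at this
    exact hbx this
  have := N.eRk_insert_eq_add_one (e := b) (X := {x, a}) ⟨hL'.1.subset_ground hb, hbcl⟩
  rw [hr2] at this
  have heq : ({x, a, b} : Set α) = insert b {x, a} := by ext; simp; tauto
  rw [heq, this]; rfl

/-- **(b) The outside point of a rank-`3` set through two lines is unique**: for `a, a' ∈ L ∖ x`,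
`b, b' ∈ L' ∖ x` and `s, s' ∉ L ∪ L'` with `r {x, a, b, s} = r {x, a', b', s'} = 3`, `s = s'` (both lie in the
plane `cl (L ∪ L')`, which has `≤ 6` points and already holds the `5` of `L ∪ L'`). -/
theorem eq_of_eRk_three_two_lines (N : Matroid α) [N.Finite]
    (hC1 : ∀ L ⊆ N.E, N.eRk L = 2 → L.ncard ≤ 3) (hC2 : ∀ P ⊆ N.E, N.eRk P ≤ 3 → P.ncard ≤ 6)
    {x : α} {L L' : Set α} (hL : L ∈ ThmN.trianglesThrough N x) (hL' : L' ∈ ThmN.trianglesThrough N x)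
    (hne : L ≠ L') {a a' b b' s s' : α} (ha : a ∈ L) (hax : a ≠ x) (ha' : a' ∈ L) (ha'x : a' ≠ x)
    (hb : b ∈ L') (hbx : b ≠ x) (hb' : b' ∈ L') (hb'x : b' ≠ x) (hs : s ∈ N.E) (hs' : s' ∈ N.E)
    (hsL : s ∉ L ∪ L') (hs'L : s' ∉ L ∪ L') (hr : N.eRk {x, a, b, s} = 3) (hr' : N.eRk {x, a', b', s'} = 3) :
    s = s' := by
  have hLE := hL.1.subset_ground
  have hL'E := hL'.1.subset_ground
  -- `cl {x, a, b} = cl (L ∪ L')`, of rank `3`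
  have hsub : ∀ {a b : α}, a ∈ L → a ≠ x → b ∈ L' → b ≠ x → L ∪ L' ⊆ N.closure {x, a, b} := by
    intro a b ha hax hb hbx
    refine Set.union_subset ?_ ?_
    · refine (triangle_subset_closure_pair' N hL.1 hL.2.1 hL.2.2 ha (Ne.symm hax)).trans
        (N.closure_subset_closure ?_)
      rintro z (rfl | rfl) <;> simp
    · refine (triangle_subset_closure_pair' N hL'.1 hL'.2.1 hL'.2.2 hb (Ne.symm hbx)).trans
        (N.closure_subset_closure ?_)
      rintro z (rfl | rfl) <;> simp
  have hmem : ∀ {a b s : α}, a ∈ L → a ≠ x → b ∈ L' → b ≠ x → s ∈ N.E → N.eRk {x, a, b, s} = 3 →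
      s ∈ N.closure (L ∪ L') := by
    intro a b s ha hax hb hbx hs hr
    have h3 := eRk_triple_eq_three N hC1 hL hL' hne ha hax hb hbx
    have hxab : ({x, a, b} : Set α) ⊆ N.E := by
      rintro z (rfl | rfl | rfl)
      · exact hL.1.subset_ground hL.2.2
      · exact hLE ha
      · exact hL'E hb
    have heq : ({x, a, b, s} : Set α) = insert s {x, a, b} := by ext; simp; tauto
    have hscl : s ∈ N.closure {x, a, b} :=
      mem_closure_of_eRk_insert_le N hxab hs (by rw [← heq, hr, h3])
    exact N.closure_subset_closure (by rintro z (rfl | rfl | rfl); exact Or.inl hL.2.2; exact Or.inl ha; exact Or.inr hb) hscl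
  have hrank : N.eRk (L ∪ L') ≤ 3 := by
    calc N.eRk (L ∪ L') ≤ N.eRk (N.closure {x, a, b}) := N.eRk_mono (hsub ha hax hb hbx)
      _ = N.eRk {x, a, b} := N.eRk_closure_eq _
      _ = 3 := eRk_triple_eq_three N hC1 hL hL' hne ha hax hb hbx
  have h6 := ncard_closure_le_six_of_eRk_three N hC2 hrank
  by_contra hss
  -- `L ∪ L' ∪ {s, s'}` has `7` points inside the closure
  have h5 := ncard_union_eq_five_of_trianglesThrough N hC1 hL hL' hne
  have hsub7 : insert s (insert s' (L ∪ L')) ⊆ N.closure (L ∪ L') := by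
    refine Set.insert_subset (hmem ha hax hb hbx hs hr) (Set.insert_subset (hmem ha' ha'x hb' hb'x hs' hr') ?_)
    exact N.subset_closure _ (Set.union_subset hLE hL'E)
  have hfin : (L ∪ L').Finite := N.ground_finite.subset (Set.union_subset hLE hL'E)
  have h7 : (insert s (insert s' (L ∪ L'))).ncard = 7 := by
    rw [Set.ncard_insert_of_notMem (by simp [hsL, hss]) (hfin.insert s'),
      Set.ncard_insert_of_notMem hs'L hfin, h5]
  have := Set.ncard_le_ncard hsub7 (N.ground_finite.subset (N.closure_subset_ground _))
  omega

/-- **(a) No rank-`3` set takes one point from each of three lines through `x`**: the plane of two of the lines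
would contain the third, `7` points. -/
theorem not_eRk_three_cone (N : Matroid α) [N.Finite]
    (hC1 : ∀ L ⊆ N.E, N.eRk L = 2 → L.ncard ≤ 3) (hC2 : ∀ P ⊆ N.E, N.eRk P ≤ 3 → P.ncard ≤ 6)
    {x : α} {L₁ L₂ L₃ : Set α} (hL₁ : L₁ ∈ ThmN.trianglesThrough N x) (hL₂ : L₂ ∈ ThmN.trianglesThrough N x)
    (hL₃ : L₃ ∈ ThmN.trianglesThrough N x) (h12 : L₁ ≠ L₂) (h13 : L₁ ≠ L₃) (h23 : L₂ ≠ L₃)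
    {a₁ a₂ a₃ : α} (ha₁ : a₁ ∈ L₁) (ha₁x : a₁ ≠ x) (ha₂ : a₂ ∈ L₂) (ha₂x : a₂ ≠ x) (ha₃ : a₃ ∈ L₃) (ha₃x : a₃ ≠ x)
    (hr : N.eRk {x, a₁, a₂, a₃} = 3) : False := by
  have hL₁E := hL₁.1.subset_ground
  have hL₂E := hL₂.1.subset_ground
  have hL₃E := hL₃.1.subset_ground
  have h3 := eRk_triple_eq_three N hC1 hL₁ hL₂ h12 ha₁ ha₁x ha₂ ha₂x
  have hxab : ({x, a₁, a₂} : Set α) ⊆ N.E := by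
    rintro z (rfl | rfl | rfl)
    · exact hL₁E hL₁.2.2
    · exact hL₁E ha₁
    · exact hL₂E ha₂
  have heq : ({x, a₁, a₂, a₃} : Set α) = insert a₃ {x, a₁, a₂} := by ext; simp; tauto
  have ha₃cl : a₃ ∈ N.closure {x, a₁, a₂} :=
    mem_closure_of_eRk_insert_le N hxab (hL₃E ha₃) (by rw [← heq, hr, h3])
  -- the plane `cl {x, a₁, a₂}` contains `L₁ ∪ L₂ ∪ L₃`
  set P := N.closure {x, a₁, a₂} with hP
  have hL₁P : L₁ ⊆ P := (triangle_subset_closure_pair' N hL₁.1 hL₁.2.1 hL₁.2.2 ha₁ (Ne.symm ha₁x)).trans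
    (N.closure_subset_closure (by rintro z (rfl | rfl) <;> simp))
  have hL₂P : L₂ ⊆ P := (triangle_subset_closure_pair' N hL₂.1 hL₂.2.1 hL₂.2.2 ha₂ (Ne.symm ha₂x)).trans
    (N.closure_subset_closure (by rintro z (rfl | rfl) <;> simp))
  have hL₃P : L₃ ⊆ P := by
    refine (triangle_subset_closure_pair' N hL₃.1 hL₃.2.1 hL₃.2.2 ha₃ (Ne.symm ha₃x)).trans ?_
    have : ({x, a₃} : Set α) ⊆ P := by
      rintro z (rfl | rfl)
      · exact N.subset_closure _ hxab (by simp)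
      · exact ha₃cl
    calc N.closure {x, a₃} ⊆ N.closure P := N.closure_subset_closure this
      _ = P := N.closure_closure _
  have hrank : N.eRk {x, a₁, a₂} ≤ 3 := h3.le
  have h6 := ncard_closure_le_six_of_eRk_three N hC2 hrank
  -- but `L₁ ∪ L₂ ∪ L₃` has `7` points
  have h5 := ncard_union_eq_five_of_trianglesThrough N hC1 hL₁ hL₂ h12
  have hint : (L₁ ∪ L₂) ∩ L₃ = {x} := by
    have h13' := ThmN.inter_eq_singleton_of_mem_trianglesThrough N hC1 hL₁ hL₃ h13
    have h23' := ThmN.inter_eq_singleton_of_mem_trianglesThrough N hC1 hL₂ hL₃ h23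
    rw [Set.union_inter_distrib_right, h13', h23', Set.union_self]
  have h7 : (L₁ ∪ L₂ ∪ L₃).ncard = 7 := by
    have h := Set.ncard_union_add_ncard_inter (L₁ ∪ L₂) L₃
      (N.ground_finite.subset (Set.union_subset hL₁E hL₂E)) (N.ground_finite.subset hL₃E)
    rw [hint, Set.ncard_singleton, h5, hL₃.2.1] at h
    omega
  have := Set.ncard_le_ncard (Set.union_subset (Set.union_subset hL₁P hL₂P) hL₃P)
    (N.ground_finite.subset (N.closure_subset_ground _))
  rw [hP] at this
  omega

/-- **(c) Two outside points are coplanar with `x` and at most one line**: for `s ≠ t` outside the cone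
`L ∪ L' ∪ …` (on no triangle through `x`), `a ∈ L ∖ x`, `a' ∈ L' ∖ x` with `r {x, a, s, t} = r {x, a', s, t} = 3`
is impossible — the plane `cl {x, s, t}` would hold `L ∪ L' ∪ {s, t}`, `7` points. -/
theorem not_eRk_three_pair_two_lines (N : Matroid α) [N.Finite]
    (hC1 : ∀ L ⊆ N.E, N.eRk L = 2 → L.ncard ≤ 3) (hC2 : ∀ P ⊆ N.E, N.eRk P ≤ 3 → P.ncard ≤ 6)
    (hcirc : ∀ C, N.IsCircuit C → 3 ≤ C.ncard)
    {x : α} {L L' : Set α} (hL : L ∈ ThmN.trianglesThrough N x) (hL' : L' ∈ ThmN.trianglesThrough N x)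
    (hne : L ≠ L') {a a' s t : α} (ha : a ∈ L) (hax : a ≠ x) (ha' : a' ∈ L') (ha'x : a' ≠ x)
    (hs : s ∈ N.E) (ht : t ∈ N.E) (hst : s ≠ t) (hsL : s ∉ L ∪ L') (htL : t ∉ L ∪ L')
    (hnotri : ∀ C ∈ ThmN.trianglesThrough N x, s ∉ C)
    (hr : N.eRk {x, a, s, t} = 3) (hr' : N.eRk {x, a', s, t} = 3) : False := by
  have hLE := hL.1.subset_ground
  have hL'E := hL'.1.subset_ground
  have hxE : x ∈ N.E := hLE hL.2.2
  have hxs : x ≠ s := fun h => hsL (Or.inl (h ▸ hL.2.2))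
  have hxt : x ≠ t := fun h => htL (Or.inl (h ▸ hL.2.2))
  have hxst : ({x, s, t} : Set α) ⊆ N.E := by rintro z (rfl | rfl | rfl) <;> assumption
  -- `{x, s, t}` is independent: a circuit inside it would be a triangle through `x` containing `s`
  have hind : N.Indep {x, s, t} := by
    by_contra hdep
    obtain ⟨C, hCsub, hC⟩ := (N.dep_iff.2 ⟨hdep, hxst⟩).exists_isCircuit_subset
    have hC3 := hcirc C hC
    have hcard : ({x, s, t} : Set α).ncard = 3 := by
      rw [Set.ncard_insert_of_notMem (by simp [hxs, hxt]), Set.ncard_pair hst]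
    have hCeq : C = {x, s, t} := Set.eq_of_subset_of_ncard_le hCsub (by omega) (Set.toFinite _)
    exact hnotri C ⟨hC, by rw [hCeq]; exact hcard, by rw [hCeq]; simp⟩ (by rw [hCeq]; simp)
  have hr3 : N.eRk {x, s, t} = 3 := by
    rw [hind.eRk_eq_encard, ← (Set.toFinite _).cast_ncard_eq,
      Set.ncard_insert_of_notMem (by simp [hxs, hxt]), Set.ncard_pair hst]
    rfl
  set Q := N.closure {x, s, t} with hQ
  have hmem : ∀ {a : α} {L : Set α}, L ∈ ThmN.trianglesThrough N x → a ∈ L → a ≠ x → N.eRk {x, a, s, t} = 3 →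
      L ⊆ Q := by
    intro a L hL ha hax hr
    have heq : ({x, a, s, t} : Set α) = insert a {x, s, t} := by ext; simp; tauto
    have hacl : a ∈ N.closure {x, s, t} :=
      mem_closure_of_eRk_insert_le N hxst (hL.1.subset_ground ha) (by rw [← heq, hr, hr3])
    refine (triangle_subset_closure_pair' N hL.1 hL.2.1 hL.2.2 ha (Ne.symm hax)).trans ?_
    have : ({x, a} : Set α) ⊆ Q := by
      rintro z (rfl | rfl)
      · exact N.subset_closure _ hxst (by simp)
      · exact hacl
    calc N.closure {x, a} ⊆ N.closure Q := N.closure_subset_closure this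
      _ = Q := N.closure_closure _
  have hLQ : L ⊆ Q := hmem hL ha hax hr
  have hL'Q : L' ⊆ Q := hmem hL' ha' ha'x hr'
  have h6 := ncard_closure_le_six_of_eRk_three N hC2 hr3.le
  have h5 := ncard_union_eq_five_of_trianglesThrough N hC1 hL hL' hne
  have hfin : (L ∪ L').Finite := N.ground_finite.subset (Set.union_subset hLE hL'E)
  have hsub7 : insert s (insert t (L ∪ L')) ⊆ Q := by
    refine Set.insert_subset (N.subset_closure _ hxst (by simp)) (Set.insert_subset (N.subset_closure _ hxst (by simp)) ?_)
    exact Set.union_subset hLQ hL'Q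
  have h7 : (insert s (insert t (L ∪ L'))).ncard = 7 := by
    rw [Set.ncard_insert_of_notMem (by simp [hsL, hst]) (hfin.insert t),
      Set.ncard_insert_of_notMem htL hfin, h5]
  have := Set.ncard_le_ncard hsub7 (N.ground_finite.subset (N.closure_subset_ground _))
  rw [hQ] at this
  omega

end S1

end PercRepro
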